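import Mathlib

/-!
# Kernel-checkable algebraic certificates for the typed point-split count
(blind cell PercRepro2, night-3 g25, 2026-08-29; `proofs/NIGHT3-CERT.md` §34)

The typed point-split count of a multigraph `H = (V, M)` with source `s` and split point `v`
(`NIGHT3-CERT.md` §33.1) is `T(f, g) = Σ_{A ⊆ M : v ∈ R_A} (f(R_A) − f(B_A))·(g(R_A) − g(B_A))`,
`R_A` / `B_A` the red / blue cluster of `s` under the 2-colouring `A` (red = `A`, blue = `M ∖ A`).
An **algebraic certificate** for `T ≥ 0` on all increasing `f, g` is an identity of bilinear forms
`T(f, g) = Σ_k λ_k (f(P_k) − f(Q_k))(g(P'_k) − g(Q'_k))` with `λ_k ≥ 0` and `Q_k ⊆ P_k`, `Q'_k ⊆ P'_k`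
(§33.2, the tensor-cone certificate).  This file gives the **bitmask model** of `T` (vertices `< n`,
vertex sets and colourings as `Nat` bitmasks, the cluster by `|M|` closure rounds — everything
kernel-reducible) together with a Boolean checker `checkCert` of a certificate and the soundness
theorem **`Tform_nonneg_of_checkCert`**: `checkCert edges s v cert = true` implies
`0 ≤ Tform edges s v f g` for every pair of functions monotone under mask inclusion.  A certificate
for a concrete minor is then a kernel proof `by decide +kernel` (no extra axiom; the data files
`TypedCountCertN*.lean` carry them).  Proof: both sides of the identity are sums of monomials
`c · f X · g Y` (`evalEntries`); a sum of monomials depends only on the aggregated coefficient of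
each key `(X, Y)` (`evalEntries_eq_sum_agg`), the checker compares exactly these aggregates on every
key occurring on either side, and each certificate line is a product of two nonnegative increments.

The bridge between the bitmask model and the `Set`-valued `cluster` of `Graph.lean` is not part of
this file (the statement here is about the bitmask model).  Own work; standard axioms.
-/

namespace Summit.Ventures.PercRepro2

namespace TypedCert

/-- Edges of a multigraph on the vertices `< n`, as index pairs; edge `i` is `edges[i]`.  A colouring
is a bitmask over the edge indices (bit `i` set = edge `i` red); a vertex set is a bitmask over the
vertices. -/
abbrev Edges := List (Nat × Nat)

/-- One closure round: every red edge with an endpoint in `C` adds both of its endpoints. -/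
def closeStep (edges : Edges) (A : Nat) (C : Nat) : Nat :=
  (List.range edges.length).foldl
    (fun C' i =>
      match edges[i]? with
      | some (a, b) =>
        if A.testBit i && (C'.testBit a || C'.testBit b) then C' ||| (1 <<< a) ||| (1 <<< b) else C'
      | none => C') C

/-- The red cluster of `s` under the colouring `A`, as a vertex mask (`edges.length` closure rounds
suffice: each round before stabilisation adds a vertex through a new edge). -/
def clusterMask (edges : Edges) (A : Nat) (s : Nat) : Nat :=
  Nat.iterate (closeStep edges A) edges.length (1 <<< s)

/-- The complementary colouring within `m` edges. -/
def flipMask (m : Nat) (A : Nat) : Nat := ((1 <<< m) - 1) ^^^ A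

/-- Mask inclusion `X ⊆ Y`. -/
def MaskLE (X Y : Nat) : Prop := X &&& Y = X

/-- A function on vertex masks is increasing (for mask inclusion). -/
def MonoMask {R : Type*} [LE R] (f : Nat → R) : Prop := ∀ X Y, MaskLE X Y → f X ≤ f Y

/-- The typed point-split count in the bitmask model:
`Σ_{A < 2^m : v ∈ R_A} (f R_A − f B_A)(g R_A − g B_A)`. -/
def Tform {R : Type*} [CommRing R] (edges : Edges) (s v : Nat) (f g : Nat → R) : R :=
  ((List.range (1 <<< edges.length)).map (fun A =>
    let Rm := clusterMask edges A s
    let Bm := clusterMask edges (flipMask edges.length A) s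
    if Rm.testBit v then (f Rm - f Bm) * (g Rm - g Bm) else 0)).sum

/-- An entry `(X, Y, c)` stands for the monomial `c · f X · g Y`. -/
abbrev Entry := Nat × Nat × Int

/-- The key `(X, Y)` of an entry. -/
def keyOf (e : Entry) : Nat × Nat := (e.1, e.2.1)

/-- The four entries of one colouring `A` with `v` red-connected: `(f R − f B)(g R − g B)`. -/
def termEntries (edges : Edges) (s v : Nat) (A : Nat) : List Entry :=
  let Rm := clusterMask edges A s
  let Bm := clusterMask edges (flipMask edges.length A) s
  if Rm.testBit v then [(Rm, Rm, 1), (Rm, Bm, -1), (Bm, Rm, -1), (Bm, Bm, 1)] else []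

/-- All entries of the typed count. -/
def entriesT (edges : Edges) (s v : Nat) : List Entry :=
  (List.range (1 <<< edges.length)).flatMap (termEntries edges s v)

/-- A certificate line `(λ, P, Q, P', Q')` stands for `λ · (f P − f Q) · (g P' − g Q')`. -/
abbrev Line := Int × Nat × Nat × Nat × Nat

/-- The four entries of a certificate line. -/
def lineEntries (l : Line) : List Entry :=
  [(l.2.1, l.2.2.2.1, l.1), (l.2.2.1, l.2.2.2.1, -l.1), (l.2.1, l.2.2.2.2, -l.1),
   (l.2.2.1, l.2.2.2.2, l.1)]

/-- All entries of a certificate. -/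
def entriesC (cert : List Line) : List Entry := cert.flatMap lineEntries

/-- The aggregated coefficient of the key `k` in an entry list. -/
def agg (l : List Entry) (k : Nat × Nat) : Int :=
  (l.map (fun e => if keyOf e = k then e.2.2 else 0)).sum

/-- A line is admissible: nonnegative coefficient, comparable pairs. -/
def lineOK (l : Line) : Bool :=
  decide (0 ≤ l.1) && decide (l.2.2.1 &&& l.2.1 = l.2.2.1) && decide (l.2.2.2.2 &&& l.2.2.2.1 = l.2.2.2.2)

/-- Strict lexicographic order on keys. -/
def keyLT (a b : Nat × Nat) : Bool := decide (a.1 < b.1) || (decide (a.1 = b.1) && decide (a.2 < b.2))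

/-- Insert an entry into a key-sorted list, merging equal keys. -/
def insertEntry (e : Entry) : List Entry → List Entry
  | [] => [e]
  | e' :: l =>
    if keyOf e = keyOf e' then (e'.1, e'.2.1, e'.2.2 + e.2.2) :: l
    else if keyLT (keyOf e) (keyOf e') then e :: e' :: l
    else e' :: insertEntry e l

/-- The normal form of an entry list: key-sorted, merged, zero coefficients dropped. -/
def normalize (l : List Entry) : List Entry :=
  (l.foldl (fun acc e => insertEntry e acc) []).filter (fun e => decide (e.2.2 ≠ 0))

/-- The checker: every line admissible, and the normal forms of the entry lists of `T` and of the
certificate coincide (hence their aggregated coefficients agree on every key). -/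
def checkCert (edges : Edges) (s v : Nat) (cert : List Line) : Bool :=
  cert.all lineOK && decide (normalize (entriesT edges s v) = normalize (entriesC cert))

section Algebra

variable {R : Type*} [CommRing R]

/-- The value of an entry list: `Σ c · f X · g Y`. -/
def evalEntries (l : List Entry) (f g : Nat → R) : R :=
  (l.map (fun e => (e.2.2 : R) * f e.1 * g e.2.1)).sum

/-- The empty entry list has value `0`. -/
lemma evalEntries_nil (f g : Nat → R) : evalEntries [] f g = 0 := by
  simp [evalEntries]

/-- The value of `e :: l` is the monomial of `e` plus the value of `l`. -/
lemma evalEntries_cons (e : Entry) (l : List Entry) (f g : Nat → R) :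
    evalEntries (e :: l) f g = (e.2.2 : R) * f e.1 * g e.2.1 + evalEntries l f g := by
  simp [evalEntries]

/-- The value is additive under concatenation. -/
lemma evalEntries_append (l₁ l₂ : List Entry) (f g : Nat → R) :
    evalEntries (l₁ ++ l₂) f g = evalEntries l₁ f g + evalEntries l₂ f g := by
  simp [evalEntries]

/-- The value of a `flatMap` is the sum of the values of the pieces. -/
lemma evalEntries_flatMap {α : Type*} (l : List α) (h : α → List Entry) (f g : Nat → R) :
    evalEntries (l.flatMap h) f g = (l.map (fun x => evalEntries (h x) f g)).sum := by
  induction l with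
  | nil => simp [evalEntries]
  | cons x l ih => simp [List.flatMap_cons, evalEntries_append, ih]

/-- The four entries of a colouring evaluate to its term `(f R − f B)(g R − g B)` (or `0`). -/
lemma evalEntries_termEntries (edges : Edges) (s v A : Nat) (f g : Nat → R) :
    evalEntries (termEntries edges s v A) f g =
      (let Rm := clusterMask edges A s
       let Bm := clusterMask edges (flipMask edges.length A) s
       if Rm.testBit v then (f Rm - f Bm) * (g Rm - g Bm) else 0) := by
  simp only [termEntries]
  split_ifs with h
  · simp only [evalEntries, List.map_cons, List.map_nil, List.sum_cons, List.sum_nil]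
    push_cast
    ring
  · simp [evalEntries]

/-- `T` is the value of its entry list. -/
lemma Tform_eq_evalEntries (edges : Edges) (s v : Nat) (f g : Nat → R) :
    Tform edges s v f g = evalEntries (entriesT edges s v) f g := by
  simp only [Tform, entriesT, evalEntries_flatMap, evalEntries_termEntries]

/-- The four entries of a certificate line evaluate to `λ (f P − f Q)(g P' − g Q')`. -/
lemma evalEntries_lineEntries (l : Line) (f g : Nat → R) :
    evalEntries (lineEntries l) f g =
      (l.1 : R) * (f l.2.1 - f l.2.2.1) * (g l.2.2.2.1 - g l.2.2.2.2) := by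
  simp only [lineEntries, evalEntries, List.map_cons, List.map_nil, List.sum_cons, List.sum_nil]
  push_cast
  ring

/-- The empty list has aggregate `0` at every key. -/
lemma agg_nil (k : Nat × Nat) : agg [] k = 0 := by simp [agg]

/-- The aggregate of `e :: l` at `k` is the coefficient of `e` (if its key is `k`) plus that of `l`. -/
lemma agg_cons (e : Entry) (l : List Entry) (k : Nat × Nat) :
    agg (e :: l) k = (if keyOf e = k then e.2.2 else 0) + agg l k := by
  simp [agg]

/-- Inserting an entry adds its coefficient to the aggregate of its key and nothing else. -/
lemma agg_insertEntry (e : Entry) (l : List Entry) (k : Nat × Nat) :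
    agg (insertEntry e l) k = (if keyOf e = k then e.2.2 else 0) + agg l k := by
  induction l with
  | nil => simp [insertEntry, agg_cons, agg_nil]
  | cons e' l ih =>
    by_cases h1 : keyOf e = keyOf e'
    · simp only [insertEntry]
      rw [if_pos h1, agg_cons, agg_cons]
      have hk : keyOf (e'.1, e'.2.1, e'.2.2 + e.2.2) = keyOf e' := rfl
      rw [hk, h1]
      split_ifs <;> (try dsimp only) <;> ring
    · by_cases h2 : keyLT (keyOf e) (keyOf e') = true
      · simp only [insertEntry]
        rw [if_neg h1, if_pos h2, agg_cons, agg_cons]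
      · simp only [insertEntry]
        rw [if_neg h1, if_neg h2, agg_cons, ih, agg_cons]
        ring

/-- Folding insertions into `acc` adds the aggregates of the list to those of `acc`. -/
lemma agg_foldl_insertEntry (l acc : List Entry) (k : Nat × Nat) :
    agg (l.foldl (fun acc e => insertEntry e acc) acc) k = agg l k + agg acc k := by
  induction l generalizing acc with
  | nil => simp [agg_nil]
  | cons e l ih =>
    rw [List.foldl_cons, ih, agg_insertEntry, agg_cons]
    ring

/-- Dropping the zero-coefficient entries does not change any aggregate. -/
lemma agg_filter_nonzero (l : List Entry) (k : Nat × Nat) :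
    agg (l.filter (fun e => decide (e.2.2 ≠ 0))) k = agg l k := by
  induction l with
  | nil => simp
  | cons e l ih =>
    by_cases h : e.2.2 = 0
    · have : (l.filter (fun e => decide (e.2.2 ≠ 0))) = (e :: l).filter (fun e => decide (e.2.2 ≠ 0)) := by
        simp [h]
      rw [← this, ih, agg_cons, h]
      simp
    · rw [List.filter_cons_of_pos (by simpa using h), agg_cons, agg_cons, ih]

/-- The normal form has the same aggregated coefficients. -/
lemma agg_normalize (l : List Entry) (k : Nat × Nat) : agg (normalize l) k = agg l k := by
  simp only [normalize]
  rw [agg_filter_nonzero, agg_foldl_insertEntry, agg_nil, add_zero]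

/-- A sum of monomials depends only on the aggregated coefficients of its keys. -/
lemma evalEntries_eq_sum_agg (l : List Entry) (S : Finset (Nat × Nat))
    (hS : ∀ e ∈ l, keyOf e ∈ S) (f g : Nat → R) :
    evalEntries l f g = ∑ k ∈ S, (agg l k : R) * f k.1 * g k.2 := by
  induction l with
  | nil => simp [evalEntries_nil, agg_nil]
  | cons e l ih =>
    have hS' : ∀ e' ∈ l, keyOf e' ∈ S := fun e' he' => hS e' (List.mem_cons_of_mem e he')
    have he : keyOf e ∈ S := hS e (List.mem_cons_self ..)
    rw [evalEntries_cons, ih hS']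
    simp only [agg_cons]
    push_cast
    simp only [add_mul, Finset.sum_add_distrib]
    congr 1
    rw [Finset.sum_eq_single (keyOf e)]
    · simp [keyOf]
    · intro b _ hb
      simp [Ne.symm hb]
    · intro h
      exact absurd he h

end Algebra

section Soundness

variable {R : Type*} [Field R] [LinearOrder R] [IsStrictOrderedRing R]

/-- The value of an admissible certificate is nonnegative for increasing `f, g`. -/
lemma evalEntries_entriesC_nonneg (cert : List Line) (hc : cert.all lineOK = true)
    (f g : Nat → R) (hf : MonoMask f) (hg : MonoMask g) :
    0 ≤ evalEntries (entriesC cert) f g := by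
  simp only [entriesC, evalEntries_flatMap, evalEntries_lineEntries]
  apply List.sum_nonneg
  intro x hx
  rw [List.mem_map] at hx
  obtain ⟨l, hl, rfl⟩ := hx
  have hok := (List.all_eq_true.mp hc) l hl
  simp only [lineOK, Bool.and_eq_true, decide_eq_true_eq] at hok
  obtain ⟨⟨h0, hQ⟩, hQ'⟩ := hok
  have h1 : f l.2.2.1 ≤ f l.2.1 := hf _ _ hQ
  have h2 : g l.2.2.2.2 ≤ g l.2.2.2.1 := hg _ _ hQ'
  have h0' : (0 : R) ≤ (l.1 : R) := by exact_mod_cast h0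
  exact mul_nonneg (mul_nonneg h0' (sub_nonneg.mpr h1)) (sub_nonneg.mpr h2)

/-- **Soundness of the checker**: a verified certificate proves `T ≥ 0` for every pair of functions
increasing under mask inclusion. -/
theorem Tform_nonneg_of_checkCert (edges : Edges) (s v : Nat) (cert : List Line)
    (h : checkCert edges s v cert = true) (f g : Nat → R) (hf : MonoMask f) (hg : MonoMask g) :
    0 ≤ Tform edges s v f g := by
  simp only [checkCert, Bool.and_eq_true] at h
  obtain ⟨hc, hagree⟩ := h
  set lT := entriesT edges s v with hlT
  set lC := entriesC cert with hlC
  set S : Finset (Nat × Nat) := ((lT ++ lC).map keyOf).toFinset with hSdef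
  have hST : ∀ e ∈ lT, keyOf e ∈ S := by
    intro e he
    simp only [hSdef, List.mem_toFinset, List.mem_map]
    exact ⟨e, List.mem_append_left _ he, rfl⟩
  have hSC : ∀ e ∈ lC, keyOf e ∈ S := by
    intro e he
    simp only [hSdef, List.mem_toFinset, List.mem_map]
    exact ⟨e, List.mem_append_right _ he, rfl⟩
  have hkey : ∀ k ∈ S, agg lT k = agg lC k := by
    intro k _
    have hn : normalize lT = normalize lC := by simpa using hagree
    rw [← agg_normalize lT k, hn, agg_normalize]
  rw [Tform_eq_evalEntries, ← hlT, evalEntries_eq_sum_agg lT S hST]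
  have hsum : ∑ k ∈ S, (agg lT k : R) * f k.1 * g k.2 = ∑ k ∈ S, (agg lC k : R) * f k.1 * g k.2 := by
    apply Finset.sum_congr rfl
    intro k hk
    rw [hkey k hk]
  rw [hsum, ← evalEntries_eq_sum_agg lC S hSC]
  exact evalEntries_entriesC_nonneg cert hc f g hf hg

end Soundness

/-! ## Scaled certificates
A certificate with half-integer coefficients is stored with every coefficient multiplied by a positive
integer `k` (the common denominator); it then certifies `k · T` — so the checker compares it with the
entries of `T` scaled by `k`. -/

/-- The entries of `k · T`: every coefficient of `entriesT` multiplied by `k`. -/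
def entriesTScaled (edges : Edges) (s v : Nat) (k : Int) : List Entry :=
  (entriesT edges s v).map (fun e => (e.1, e.2.1, k * e.2.2))

/-- The scaled checker: `k > 0`, every line admissible, and the normal forms of the entry lists of
`k · T` and of the certificate coincide. -/
def checkCertScaled (edges : Edges) (s v : Nat) (k : Int) (cert : List Line) : Bool :=
  decide (0 < k) && cert.all lineOK &&
    decide (normalize (entriesTScaled edges s v k) = normalize (entriesC cert))

section ScaledAlgebra

variable {R : Type*} [CommRing R]

/-- Scaling every coefficient by `k` scales the value by `k`. -/
lemma evalEntries_map_scale (l : List Entry) (k : Int) (f g : Nat → R) :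
    evalEntries (l.map (fun e => (e.1, e.2.1, k * e.2.2))) f g = (k : R) * evalEntries l f g := by
  induction l with
  | nil => simp [evalEntries_nil]
  | cons e l ih =>
    rw [List.map_cons, evalEntries_cons, evalEntries_cons, ih]
    push_cast
    ring

/-- The value of the scaled entries of `T` is `k · T`. -/
lemma evalEntries_entriesTScaled (edges : Edges) (s v : Nat) (k : Int) (f g : Nat → R) :
    evalEntries (entriesTScaled edges s v k) f g = (k : R) * Tform edges s v f g := by
  rw [entriesTScaled, evalEntries_map_scale, Tform_eq_evalEntries]

end ScaledAlgebra

section ScaledSoundness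

variable {R : Type*} [Field R] [LinearOrder R] [IsStrictOrderedRing R]

/-- **Soundness of the scaled checker**: a verified scaled certificate proves `T ≥ 0` for every pair
of functions increasing under mask inclusion. -/
theorem Tform_nonneg_of_checkCertScaled (edges : Edges) (s v : Nat) (k : Int) (cert : List Line)
    (h : checkCertScaled edges s v k cert = true) (f g : Nat → R) (hf : MonoMask f)
    (hg : MonoMask g) : 0 ≤ Tform edges s v f g := by
  simp only [checkCertScaled, Bool.and_eq_true, decide_eq_true_eq] at h
  obtain ⟨⟨hk, hc⟩, hagree⟩ := h
  set lT := entriesTScaled edges s v k with hlT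
  set lC := entriesC cert with hlC
  set S : Finset (Nat × Nat) := ((lT ++ lC).map keyOf).toFinset with hSdef
  have hST : ∀ e ∈ lT, keyOf e ∈ S := by
    intro e he
    simp only [hSdef, List.mem_toFinset, List.mem_map]
    exact ⟨e, List.mem_append_left _ he, rfl⟩
  have hSC : ∀ e ∈ lC, keyOf e ∈ S := by
    intro e he
    simp only [hSdef, List.mem_toFinset, List.mem_map]
    exact ⟨e, List.mem_append_right _ he, rfl⟩
  have hkey : ∀ k' ∈ S, agg lT k' = agg lC k' := by
    intro k' _
    rw [← agg_normalize lT k', hagree, agg_normalize]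
  have hval : evalEntries lT f g = evalEntries lC f g := by
    rw [evalEntries_eq_sum_agg lT S hST, evalEntries_eq_sum_agg lC S hSC]
    apply Finset.sum_congr rfl
    intro k' hk'
    rw [hkey k' hk']
  have hpos : (0 : R) < (k : R) := by exact_mod_cast hk
  have hnn : 0 ≤ (k : R) * Tform edges s v f g := by
    rw [← evalEntries_entriesTScaled, ← hlT, hval]
    exact evalEntries_entriesC_nonneg cert hc f g hf hg
  exact nonneg_of_mul_nonneg_right hnn hpos

end ScaledSoundness

end TypedCert

end Summit.Ventures.PercRepro2
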